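import Literature.NumberTheory.Transcendental.NestedChartConvexCovers
import HarnessLib

/-!
# Nested chart-convex finite covers subordinate to a given open cover

Companion of `Literature.NumberTheory.Transcendental.NestedChartConvexCovers`
(`exists_nestedChartConvexCovers`: the nested Leray "Meßatlanten" `𝔘_0 < 𝔘_1 < ⋯ < 𝔘_L` of a
compact boundaryless manifold by Euclidean chart balls, H. Grauert, R. Remmert, *Theorie der
Steinschen Räume* (1977), Kap. VI §4). For the Cartan–Serre finiteness theorem with coefficients
in a holomorphic line bundle (a Čech cocycle on a trivialising open cover) the covers must moreover
REFINE a prescribed open cover (Grauert–Remmert, loc. cit., Kap. VI §4.1: the Meßatlas is chosen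
subordinate to a cover on which the coherent sheaf is presented). This file proves exactly that
variant:

* `exists_nestedChartConvexCovers_subordinate L O` — for every `L` and every open cover
  `O : κ → Set M` there are a finite `s ⊆ M` and covers `U l : ↥s → Set M`, `l : Fin (L + 1)`,
  with all the properties of `exists_nestedChartConvexCovers` (open; covering; increasing in `l`;
  `closure U_{l,J} ⊆ U_{l',J}` for `l < l'` on all finite intersections; each tuple's nonempty
  intersections are chart sets of open convex sets in ONE chart) AND `∀ l i, ∃ k, U l i ⊆ O k`.

The proof is the proof of `exists_nestedChartConvexCovers` verbatim, run with a Lebesgue number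
of the cover `{source (chartAt p) ∩ O k}` instead of `{source (chartAt p)}`: the balls of the
construction have `d`-radius below a third of that Lebesgue number, whence the subordination.
Everything is proved; no definitions.

## References

* H. Grauert, R. Remmert, *Theorie der Steinschen Räume* (1977), Kap. VI §4.1 (Meßatlanten).
  [GrauertRemmert1977]
* R. Bott, L. W. Tu, *Differential Forms in Algebraic Topology* (1982), Thm. 5.1 (good covers).
  [BottTu1982Forms]
-/

noncomputable section

open scoped Manifold ContDiff Topology
open Set Metric Filter Literature.Geometry.Kaehler Literature.Analysis.Convexity
open Literature.NumberTheory.Transcendental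

universe u

namespace Literature.Geometry.Kaehler

variable {E : Type*} [NormedAddCommGroup E] [NormedSpace ℝ E] [FiniteDimensional ℝ E]
  {M : Type u} [TopologicalSpace M] [ChartedSpace E M]

/-- **Compact boundaryless manifolds have nested chart-convex finite covers subordinate to any open
cover** (the Leray "Meßatlanten" `𝔘_0 < ⋯ < 𝔘_L` of Grauert–Remmert (1977), Kap. VI §4.1, by
Euclidean chart balls of radii `r 2^l / 2^L` about the same centres, of `d`-diameter below a
Lebesgue number of the cover `{source (chartAt p) ∩ O k}`): open sets, every level covering,
increasing in `l`, `closure U_{l,J} ⊆ U_{l',J}` for `l < l'` on all finite intersections, one chart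
centre per tuple in which every nonempty `U_{l,J}` is the chart set of an open convex subset of the
chart target, and every `U l i` inside some `O k`. [cite: GrauertRemmert1977, Kap. VI §4.1] -/
theorem exists_nestedChartConvexCovers_subordinate [IsManifold 𝓘(ℝ, E) ∞ M] [T2Space M] [CompactSpace M]
    (L : ℕ) {κ : Type*} (O : κ → Set M) (hO : ∀ k, IsOpen (O k)) (hOcov : ∀ x, ∃ k, x ∈ O k) :
    ∃ (s : Finset M) (U : Fin (L + 1) → ↥s → Set M),
      (∀ l i, IsOpen (U l i)) ∧ (∀ l, ⋃ i, U l i = univ) ∧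
      (∀ l l', l ≤ l' → ∀ i, U l i ⊆ U l' i) ∧
      (∀ l l', l < l' → ∀ (n : ℕ) (J : Fin n → ↥s), closure (cechSet (U l) J) ⊆ cechSet (U l') J) ∧
      (∀ (n : ℕ) (J : Fin (n + 1) → ↥s), ∃ p : M, ∀ l, (cechSet (U l) J).Nonempty →
        ∃ C : Set E, IsOpen C ∧ Convex ℝ C ∧ C ⊆ (chartAt E p).target ∧
          cechSet (U l) J = chartSet 𝓘(ℝ, E) p C) ∧
      (∀ l i, ∃ k, U l i ⊆ O k) := by
  classical
  rcases isEmpty_or_nonempty M with hM | hM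
  · exact ⟨∅, fun _ _ ↦ ∅, fun _ _ ↦ isOpen_empty, fun _ ↦ eq_univ_of_forall fun x ↦ isEmptyElim x,
      fun _ _ _ _ ↦ Subset.rfl, fun _ _ _ n J x _ ↦ isEmptyElim x,
      fun n J ↦ absurd (J 0).2 (Finset.notMem_empty _), fun l i ↦ absurd i.2 (Finset.notMem_empty _)⟩
  -- a metric on `M`
  letI : TopologicalSpace.MetrizableSpace M := Manifold.metrizableSpace 𝓘(ℝ, E) M
  letI : MetricSpace M := TopologicalSpace.metrizableSpaceMetric M
  -- a finite atlas and a Lebesgue number `3η` of the atlas refined by the cover `O`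
  obtain ⟨t, ht⟩ : ∃ t : Finset M, (univ : Set M) ⊆ ⋃ p ∈ t, (chartAt E p).source :=
    isCompact_univ.elim_finite_subcover (fun p : M ↦ (chartAt E p).source)
      (fun p ↦ (chartAt E p).open_source) fun x _ ↦ mem_iUnion.2 ⟨x, mem_chart_source E x⟩
  have htne : t.Nonempty := by
    obtain ⟨x⟩ := hM
    obtain ⟨p, hp, -⟩ := mem_iUnion₂.1 (ht (mem_univ x))
    exact ⟨p, hp⟩
  obtain ⟨lam, hlam, hleb⟩ := lebesgue_number_lemma_of_metric (ι := ↥t × κ)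
    (c := fun pk ↦ (chartAt E (pk.1 : M)).source ∩ O pk.2) isCompact_univ
    (fun pk ↦ (chartAt E (pk.1 : M)).open_source.inter (hO pk.2))
    (fun x _ ↦ by
      obtain ⟨p, hp, hx⟩ := mem_iUnion₂.1 (ht (mem_univ x))
      obtain ⟨k, hk⟩ := hOcov x
      exact mem_iUnion.2 ⟨(⟨p, hp⟩, k), hx, hk⟩)
  haveI : Nonempty (↥t × κ) := by
    obtain ⟨x⟩ := hM
    obtain ⟨k, -⟩ := hOcov x
    exact ⟨(⟨_, htne.choose_spec⟩, k)⟩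
  choose! jt hjt using hleb
  set j : M → M := fun x ↦ ((jt x).1 : M) with hj
  have hjmem : ∀ x, j x ∈ t := fun x ↦ (jt x).1.2
  have hjball : ∀ x, ball x lam ⊆ (chartAt E (j x)).source := fun x ↦
    (hjt x (mem_univ x)).trans inter_subset_left
  have hjO : ∀ x, ball x lam ⊆ O (jt x).2 := fun x ↦ (hjt x (mem_univ x)).trans inter_subset_right
  set η := lam / 3 with hη
  have hηpos : 0 < η := by positivity
  have hηlam : η ≤ lam := by rw [hη]; linarith
  -- the compact cores `Q p = {z | B_d(z, η) ⊆ source_p}`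
  set Q : M → Set M := fun p ↦ {z | ∀ w, w ∉ (chartAt E p).source → η ≤ dist z w} with hQ
  have hQclosed : ∀ p, IsClosed (Q p) := fun p ↦ by
    simp only [hQ, setOf_forall]
    exact isClosed_iInter fun w ↦ isClosed_iInter fun _ ↦
      isClosed_le continuous_const (continuous_id.dist continuous_const)
  have hQcpt : ∀ p, IsCompact (Q p) := fun p ↦ (hQclosed p).isCompact
  have hQball : ∀ p z, z ∈ Q p ↔ ball z η ⊆ (chartAt E p).source := fun p z ↦ by
    constructor
    · intro hz w hw
      by_contra hws
      have h := hz w hws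
      rw [mem_ball, dist_comm] at hw
      exact absurd hw (not_lt.2 h)
    · intro hz w hws
      by_contra hlt
      exact hws (hz (by rw [mem_ball, dist_comm]; exact not_le.1 hlt))
  have hQsrc : ∀ p, Q p ⊆ (chartAt E p).source := fun p z hz ↦
    (hQball p z).1 hz (mem_ball_self hηpos)
  -- (a) uniform continuity of `ψ_p⁻¹` near `ψ_p (Q p)`: radii `r₁ p`
  have stepA : ∀ p : M, ∃ r₁ > 0, ∀ z ∈ Q p, ∀ r, r ≤ r₁ →
      (∀ v ∈ ball (echart E p z) r, (toEuclidean (E := E)).symm v ∈ (chartAt E p).target) ∧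
        eball E p z r ⊆ ball z η := by
    intro p
    set T := (toEuclidean (E := E)).symm ⁻¹' (chartAt E p).target with hT
    have hTo : IsOpen T := (chartAt E p).open_target.preimage (toEuclidean (E := E)).symm.continuous
    set K := echart E p '' Q p with hK
    have hψc : ContinuousOn (echart E p) (chartAt E p).source :=
      (toEuclidean (E := E)).continuous.comp_continuousOn (chartAt E p).continuousOn
    have hKc : IsCompact K := (hQcpt p).image_of_continuousOn (hψc.mono (hQsrc p))
    have hKT : K ⊆ T := by
      rintro _ ⟨z, hz, rfl⟩
      show (toEuclidean (E := E)).symm (toEuclidean (E := E) (chartAt E p z)) ∈ (chartAt E p).target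
      rw [ContinuousLinearEquiv.symm_apply_apply]
      exact (chartAt E p).map_source (hQsrc p hz)
    obtain ⟨δ, hδ, hCT⟩ := hKc.exists_cthickening_subset_open hTo hKT
    have hCc : IsCompact (cthickening δ K) := hKc.cthickening
    have hFc : ContinuousOn (echartInv E p) T :=
      (chartAt E p).continuousOn_symm.comp (toEuclidean (E := E)).symm.continuous.continuousOn fun v hv ↦ hv
    have hFu := hCc.uniformContinuousOn_of_continuous (hFc.mono hCT)
    obtain ⟨r₀, hr₀, hr₀u⟩ := Metric.uniformContinuousOn_iff.1 hFu η hηpos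
    refine ⟨min r₀ δ, lt_min hr₀ hδ, fun z hz r hr ↦ ?_⟩
    have hzK : echart E p z ∈ K := ⟨z, hz, rfl⟩
    have hballC : ∀ v ∈ ball (echart E p z) r, v ∈ cthickening δ K := fun v hv ↦
      closedBall_subset_cthickening hzK δ
        (mem_closedBall.2 ((mem_ball.1 hv).le.trans (hr.trans (min_le_right _ _))))
    refine ⟨fun v hv ↦ hCT (hballC v hv), fun x hx ↦ ?_⟩
    have hxv : echart E p x ∈ ball (echart E p z) r := hx.2
    have hd := hr₀u (echart E p x) (hballC _ hxv) (echart E p z)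
      (self_subset_cthickening K hzK) ((mem_ball.1 hxv).trans_le (hr.trans (min_le_left _ _)))
    rw [echartInv_echart hx.1, echartInv_echart (hQsrc p hz)] at hd
    exact mem_ball.2 hd
  choose r₁ hr₁pos hr₁ using stepA
  -- (b) convexity of transported balls: radii `ρ p q`
  have stepB : ∀ p q : M, ∃ ρ > 0, ∀ c ∈ echart E p '' (Q p ∩ Q q), ∀ r, 0 < r → r ≤ ρ →
      ball c r ⊆ edom E p q ∧ Convex ℝ (etrans E p q '' ball c r) := by
    intro p q
    have hψc : ContinuousOn (echart E p) (chartAt E p).source :=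
      (toEuclidean (E := E)).continuous.comp_continuousOn (chartAt E p).continuousOn
    have hKc : IsCompact (echart E p '' (Q p ∩ Q q)) :=
      ((hQcpt p).inter_right (hQclosed q)).image_of_continuousOn
        (hψc.mono (inter_subset_left.trans (hQsrc p)))
    have hKD : echart E p '' (Q p ∩ Q q) ⊆ edom E p q := by
      rintro _ ⟨z, hz, rfl⟩
      rw [mem_edom_iff]
      refine ⟨?_, ?_⟩
      · show (toEuclidean (E := E)).symm (toEuclidean (E := E) (chartAt E p z)) ∈ (chartAt E p).target
        rw [ContinuousLinearEquiv.symm_apply_apply]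
        exact (chartAt E p).map_source (hQsrc p hz.1)
      · rw [echartInv_echart (hQsrc p hz.1)]
        exact hQsrc q hz.2
    have h2 : (2 : WithTop ℕ∞) ≤ ∞ := by decide
    exact exists_radius_convex_image_ball (isOpen_edom p q) (isOpen_edom q p)
      ((contDiffOn_etrans p q).of_le h2) ((contDiffOn_etrans q p).of_le h2) (mapsTo_etrans p q)
      (mapsTo_etrans q p) (fun x hx ↦ etrans_etrans hx) (fun y hy ↦ etrans_etrans hy) hKc hKD
  choose ρ hρpos hρ using stepB
  -- one radius `rr` below all `r₁ p` (`p ∈ t`) and all `ρ p q` (`p, q ∈ t`)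
  set rr := min (t.inf' htne r₁) ((t ×ˢ t).inf' (htne.product htne) fun pq ↦ ρ pq.1 pq.2) with hrr
  have hrrpos : 0 < rr := by
    refine lt_min ((Finset.lt_inf'_iff _).2 fun p _ ↦ hr₁pos p)
      ((Finset.lt_inf'_iff _).2 fun pq _ ↦ hρpos pq.1 pq.2)
  have hrr₁ : ∀ p ∈ t, rr ≤ r₁ p := fun p hp ↦
    (min_le_left _ _).trans (Finset.inf'_le _ hp)
  have hrrρ : ∀ p ∈ t, ∀ q ∈ t, rr ≤ ρ p q := fun p hp q hq ↦
    (min_le_right _ _).trans (Finset.inf'_le (fun pq : M × M ↦ ρ pq.1 pq.2)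
      (Finset.mk_mem_product hp hq))
  -- the radii of the levels: `rad l = rr * 2^l / 2^L`
  set rad : Fin (L + 1) → ℝ := fun l ↦ rr * 2 ^ (l : ℕ) / 2 ^ L with hrad
  have hradpos : ∀ l, 0 < rad l := fun l ↦ by rw [hrad]; positivity
  have hradle : ∀ l, rad l ≤ rr := fun l ↦ by
    rw [hrad, div_le_iff₀ (by positivity)]
    have hl : (2 : ℝ) ^ (l : ℕ) ≤ 2 ^ L := pow_le_pow_right₀ (by norm_num) (Nat.lt_succ_iff.1 l.2)
    nlinarith
  have hradmono : ∀ l l' : Fin (L + 1), l ≤ l' → rad l ≤ rad l' := fun l l' h ↦ by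
    rw [hrad]
    have hl : (2 : ℝ) ^ (l : ℕ) ≤ 2 ^ (l' : ℕ) := pow_le_pow_right₀ (by norm_num) h
    simp only
    gcongr
  have hradlt : ∀ l l' : Fin (L + 1), l < l' → rad l < rad l' := fun l l' h ↦ by
    rw [hrad]
    have hl : (2 : ℝ) ^ (l : ℕ) < 2 ^ (l' : ℕ) := pow_lt_pow_right₀ (by norm_num) h
    simp only
    gcongr
  -- the balls `W l x = B(x; j x, rad l)` and a finite subcover AT THE SMALLEST RADIUS
  set W : Fin (L + 1) → M → Set M := fun l x ↦ eball E (j x) x (rad l) with hW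
  have hWo : ∀ l x, IsOpen (W l x) := fun l x ↦ isOpen_eball _ _ _
  have hxQ : ∀ x, x ∈ Q (j x) := fun x ↦ (hQball _ _).2 ((ball_subset_ball hηlam).trans (hjball x))
  have hxW : ∀ l x, x ∈ W l x := fun l x ↦ mem_eball (hQsrc _ (hxQ x)) (hradpos l)
  have hWsmall : ∀ l x, W l x ⊆ ball x η := fun l x ↦
    (hr₁ (j x) x (hxQ x) (rad l) ((hradle l).trans (hrr₁ _ (hjmem x)))).2
  have hWmono : ∀ l l', l ≤ l' → ∀ x, W l x ⊆ W l' x := fun l l' h x ↦ eball_mono _ _ (hradmono l l' h)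
  have hWcl : ∀ l l', l < l' → ∀ x, closure (W l x) ⊆ W l' x := fun l l' h x ↦
    closure_eball_subset (hradlt l l' h) (hradle l')
      (hr₁ (j x) x (hxQ x) rr (hrr₁ _ (hjmem x))).1
  obtain ⟨s, hs⟩ := isCompact_univ.elim_finite_subcover (W 0) (hWo 0) fun x _ ↦ mem_iUnion.2 ⟨x, hxW 0 x⟩
  -- the covers
  let U : Fin (L + 1) → ↥s → Set M := fun l i ↦ W l i.1
  have hUo : ∀ l i, IsOpen (U l i) := fun l i ↦ hWo l i.1
  have hUcov : ∀ l, ⋃ i, U l i = univ := fun l ↦ by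
    refine eq_univ_of_forall fun x ↦ ?_
    obtain ⟨i, hi, hx⟩ := mem_iUnion₂.1 (hs (mem_univ x))
    exact mem_iUnion.2 ⟨⟨i, hi⟩, hWmono 0 l (Fin.zero_le l) i hx⟩
  have hUmono : ∀ l l', l ≤ l' → ∀ i, U l i ⊆ U l' i := fun l l' h i ↦ hWmono l l' h i.1
  have hUcl : ∀ l l', l < l' → ∀ (n : ℕ) (J : Fin n → ↥s), closure (cechSet (U l) J) ⊆ cechSet (U l') J :=
    fun l l' h n J ↦ closure_cechSet_subset_cechSet (U := U l) (U' := U l') (fun i ↦ hWcl l l' h i.1) J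
  have hUchart : ∀ (n : ℕ) (J : Fin (n + 1) → ↥s), ∃ p : M, ∀ l, (cechSet (U l) J).Nonempty →
      ∃ C : Set E, IsOpen C ∧ Convex ℝ C ∧ C ⊆ (chartAt E p).target ∧
        cechSet (U l) J = chartSet 𝓘(ℝ, E) p C := by
    intro n J
    -- one chart centre for the tuple: `p = j (J 0)`
    set x₀ : M := (J 0).1 with hx₀
    set p : M := j x₀ with hp
    have hpt : p ∈ t := hjmem x₀
    refine ⟨p, fun l hne ↦ ?_⟩
    obtain ⟨z₀, hz₀⟩ := hne
    have hz₀k : ∀ k, z₀ ∈ W l (J k).1 := fun k ↦ mem_cechSet_iff.1 hz₀ k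
    -- every member lies `η`-close to `x₀`, hence has its centre in `Q p`
    have hcentre : ∀ k, (J k).1 ∈ Q p := fun k ↦ by
      rw [hQball]
      refine Subset.trans ?_ (hjball x₀)
      intro w hw
      rw [mem_ball] at hw ⊢
      have h1 : dist z₀ (J k).1 < η := mem_ball.1 (hWsmall l _ (hz₀k k))
      have h2 : dist z₀ x₀ < η := mem_ball.1 (hWsmall l _ (hz₀k 0))
      calc dist w x₀ ≤ dist w (J k).1 + dist (J k).1 z₀ + dist z₀ x₀ := dist_triangle4 _ _ _ _
        _ < η + η + η := by rw [dist_comm (J k).1 z₀]; gcongr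
        _ = lam := by rw [hη]; ring
    -- hence (b) applies to the ball of `(J k).1` in its own chart `q = j (J k).1`, read in chart `p`
    have hkey : ∀ k, W l (J k).1 ⊆ (chartAt E p).source ∧
        Convex ℝ (chartAt E p '' W l (J k).1) := fun k ↦ by
      set y : M := (J k).1 with hy
      set q : M := j y with hq
      have hcK : echart E q y ∈ echart E q '' (Q q ∩ Q p) := ⟨y, ⟨hxQ y, hcentre k⟩, rfl⟩
      obtain ⟨hBD, hconv⟩ := hρ q p (echart E q y) hcK (rad l) (hradpos l)
        ((hradle l).trans (hrrρ q (hjmem y) p hpt))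
      obtain ⟨hsub, himg⟩ := eball_subset_source_and_image (E := E) hBD
      refine ⟨hsub, ?_⟩
      rw [image_chartAt_eq, himg]
      exact convex_image_symm hconv
    refine ⟨⋂ k, chartAt E p '' W l (J k).1, ?_, ?_, ?_, ?_⟩
    · exact isOpen_iInter_of_finite fun k ↦
        (chartAt E p).isOpen_image_of_subset_source (hWo _ _) (hkey k).1
    · exact convex_iInter fun k ↦ (hkey k).2
    · exact (iInter_subset _ 0).trans (image_subset_iff.2 fun x hx ↦ (chartAt E p).map_source ((hkey 0).1 hx))
    · rw [chartSet_self_eq, preimage_iInter, inter_iInter]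
      refine iInter_congr fun k ↦ ?_
      exact eq_source_inter_preimage_image (hkey k).1
  -- subordination: `U l i ⊆ B_d(i, η) ⊆ B_d(i, λ) ⊆ O (jt i).2`
  have hUsub : ∀ l i, ∃ k, U l i ⊆ O k := fun l i ↦
    ⟨(jt i.1).2, (hWsmall l i.1).trans ((ball_subset_ball hηlam).trans (hjO i.1))⟩
  exact ⟨s, U, hUo, hUcov, hUmono, hUcl, hUchart, hUsub⟩

end Literature.Geometry.Kaehler

end
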